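import Summits.Ventures.PercRepro.C041ZonePortCSDefs

/-!
# THEOREM R-CS on the zone port problem — case (iv), pure-type gates of both types (p6, gen 28)

Setting of `C041ZonePortCSDefs` (mine-3, C-041.md §17 (a) (iv), first half).  A 1-edge `e` at a gate of pure type
`{1}` and a 2-edge `f` at a gate of pure type `{2}`: a valid pattern with `e` red is `Good₂`, one with `f` red is
`Good₁` (`good₂_of_red_pure_gate`, `good₁_of_red_pure_gate` — THE KEY FACT), and the CLOSED patterns (`e` and `f` blue)
inject into the patterns Good on both sides by reddening `e` and `f`; so `#valid ≤ #(Good₁ ∪ Good₂) + #closed ≤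
#Good₁ + #Good₂ − #(Good₁ ∩ Good₂) + #(Good₁ ∩ Good₂)`, the excess `#valid − #Good₁ − #Good₂` is `≤ 0` and (CS)
holds (**`csOr_of_pure_gates_mixed`**).  The paper's per-group count `v − x − y ≤ 1 − (W₁ − 1)(W₂ − 1) ≤ 0` is this
charging summed over the groups.
-/

namespace PercRepro

namespace ZonePort

namespace Problem

open Finset CSCount

variable {V E : Type*}

/-- A Boolean that is not `true` is `false`. -/
theorem bool_eq_false_of_not_true {b : Bool} (h : ¬ b = true) : b = false := by
  cases b
  · rfl
  · exact absurd rfl h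

/-- Reddening two edges keeps validity. -/
theorem validOr_update2 [DecidableEq E] {P : Problem V E} {x : P.Term → Bool} (hx : P.ValidOr x) (e f : P.Term) :
    P.ValidOr (Function.update (Function.update x e true) f true) :=
  ⟨adm_update_true (adm_update_true hx.1 e) f, valOr_update _ f (valOr_update _ e hx.2)⟩

section CaseIV

variable [Fintype E] [DecidableEq E] [DecidableEq V] {P : Problem V E}

/-- **Case (iv), both pure types present**: a 1-edge `e` at a gate of type `{1}` and a 2-edge `f` at a gate of type
`{2}` give `#valid ≤ #Good₁ + #Good₂`, hence (CS). -/
theorem csOr_of_pure_gates_mixed {e f : P.Term} (hCe : P.IsGate (P.tz e.1)) (hCf : P.IsGate (P.tz f.1))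
    (he : P.ts e.1 = false) (hf : P.ts f.1 = true) (hpe : P.Pure₁ (P.tz e.1)) (hpf : P.Pure₂ (P.tz f.1)) :
    P.CSOr := by
  classical
  apply cs_of_le
  have hef : e ≠ f := fun h => by
    rw [h] at he
    rw [he] at hf
    exact Bool.noConfusion hf
  -- the closed patterns
  set BB := P.validSet.filter fun x => x e = false ∧ x f = false with hBB
  have hcover : P.validSet ⊆ P.good₁Set ∪ P.good₂Set ∪ BB := by
    intro x hx
    have hxv := mem_validSet.1 hx
    by_cases hxe : x e = true
    · exact mem_union_left _ (mem_union_right _ (mem_good₂Set.2 ⟨hxv, good₂_of_red_pure_gate hCe he hpe hxe⟩))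
    · by_cases hxf : x f = true
      · exact mem_union_left _ (mem_union_left _ (mem_good₁Set.2 ⟨hxv, good₁_of_red_pure_gate hCf hf hpf hxf⟩))
      · exact mem_union_right _ (mem_filter.2 ⟨hx, bool_eq_false_of_not_true hxe, bool_eq_false_of_not_true hxf⟩)
  have h1 : #(P.validSet) ≤ #(P.good₁Set ∪ P.good₂Set ∪ BB) := card_le_card hcover
  have h2 : #(P.good₁Set ∪ P.good₂Set ∪ BB) ≤ #(P.good₁Set ∪ P.good₂Set) + #BB := card_union_le _ _
  have h3 : #(P.good₁Set ∪ P.good₂Set) + #(P.good₁Set ∩ P.good₂Set) = #(P.good₁Set) + #(P.good₂Set) :=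
    card_union_add_card_inter _ _
  -- the closed patterns inject into the patterns Good on both sides
  have h4 : #BB ≤ #(P.good₁Set ∩ P.good₂Set) := by
    refine card_le_card_of_injOn (fun x => Function.update (Function.update x e true) f true) ?_ ?_
    · intro x hx
      rw [Finset.mem_coe, hBB, mem_filter, mem_validSet] at hx
      rw [Finset.mem_coe, mem_inter, mem_good₁Set, mem_good₂Set]
      have hv := validOr_update2 hx.1 e f
      have hxe' : Function.update (Function.update x e true) f true e = true := by
        rw [Function.update_of_ne hef, Function.update_self]
      have hxf' : Function.update (Function.update x e true) f true f = true := Function.update_self _ _ _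
      exact ⟨⟨hv, good₁_of_red_pure_gate hCf hf hpf hxf'⟩, ⟨hv, good₂_of_red_pure_gate hCe he hpe hxe'⟩⟩
    · intro x hx y hy hxy
      rw [Finset.mem_coe, hBB, mem_filter] at hx hy
      exact update2_injOn e f false false ⟨hx.2.1, hx.2.2⟩ ⟨hy.2.1, hy.2.2⟩ hxy
  omega

end CaseIV

end Problem

end ZonePort

end PercRepro
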